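import Mathlib
import HarnessLib
import HarnessLib.Audit
import Summits.AtomisticToContinuum.Statement
import Literature.MathematicalPhysics.KineticTheory.LangevinChainNESSHolds
import Summits.AtomisticToContinuum.FouriersLaw.Theorems.EmbeddedDrudeMourreNessUnique
import HarnessLib.Audit.Status.Attr

/-!
Route: ThermostatLiouville

DORMANT since 2026-08-22T12:17:03Z (reconciler: no traction for 5.3 d (last activity item-evidence-added at 2026-08-17T04:02:40Z); parked, not closed — `ledger route dormant route-AtomisticToContinuum-ThermostatLiouville --off` to react) — unstaffed, not closed; items shared with open routes are served there. `ledger route dormant <id> --off` reactivates.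

# Route ThermostatLiouville — Fourier's law read at the thermostat — a first-order Liouville theorem
for the singly-driven half-line kills the ballistic channel

X = Z ∧ F ("it suffices to show"), the conforming (gen-2) realisation of card
single-thermostat-rigidity. By the exact balance J̃ = γ(T_L − ⟨p_0²⟩) the BLR coefficient of the
(N+1)-chain is D_(N+1) = N·γ·E_N with E_N := 1/2 − e_N, e_N := ∂_δ⟨p_0²⟩ at δ = 0 (baths at T ±
δ/2), so FouriersLaw(ii) reads N·γ·E_N → κ(T) ∈ (0, ∞).
Z (THE CARD, FIRST-ORDER FORM; NO BALLISTIC CHANNEL): E_N → 0 for every T > 0, obtained from a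
LIOUVILLE THEOREM for the HALF-INFINITE pinned chain driven by ONE Langevin bath at T: its only
tempered first-order stationary functional (linear, consistent on cylinders, normalised, bounded in
weighted sup norms uniformly along the chain, annihilating L_T on temperate cylinder tests) is zero
(crux FirstOrderRigidity), plus N-uniform weighted bounds on first-order NESS responses of local
observables (crux LinearResponseTightness), via window compactness and two EXACT finite-N identities
(support RigidityGlue).
F (IMPORT SLOT, the dichotomy "ballistic or Fourier" at the thermostat): E_N → 0 ⇒ N·γ·E_N → κ_b(T)
> 0 (crux EscapeLawOfNoBallisticChannel; the engine is NOT this route's — escape-deficit's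
first-return law or any κ-proof closes it a fortiori).
With NESS uniqueness (NessUnique, shared stmt-0741), fixed-N differentiability (FirstOrderResponse)
and the response identity (ResponseIdentity), Z ∧ F is clause (ii) of FouriersLawFor, and clause (i)
is the landed existence theorem pinnedChain_exists_isSteadyState + NessUnique.
Lean: `FirstOrderRigidity ∧ LinearResponseTightness ∧ EscapeLawOfNoBallisticChannel`

## Assembly
closes (glue.lean, PROVED, rc 0): hypotheses = the seven items FirstOrderRigidity,
LinearResponseTightness, EscapeLawOfNoBallisticChannel, NessUnique, FirstOrderResponse,
ResponseIdentity, RigidityGlue; conclusion `_root_.FouriersLaw`. Logic: RigidityGlue turns ranks 2–3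
(+ the fixed-N supports) into NoBallisticChannel; unfold FouriersLaw; clause (i) =
pinnedChain_exists_isSteadyState + NessUnique; clause (ii): e_N chosen from FirstOrderResponse (c),
D (N+1) := N·γ·(1/2 − e_N) with its Tendsto from ResponseIdentity, D 0 := 0 (empty chain,
totalCurrent_zero), κ T := the witness of EscapeLawOfNoBallisticChannel (T > 0, else 1), positive by
the witness, and D → κ T by the import slot fed with NoBallisticChannel, shifted by one index
(Filter.tendsto_add_atTop_iff_nat). HarmonicCalibration is deliberately outside the assembly.

Rationale: WHY THIS LINE. BLR take δT → 0 FIRST at fixed N (BonettoLebowitzReyBellet2000 §5.3 (33)), so the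
card's nonlinear uniqueness theorem, which only yields the fixed-δT rung J̃_N → 0, is off the
logical path (that is exactly why the gen-1 route
route-AtomisticToContinuum-SingleThermostatRigidity was retired `not-a-thesis`); its FIRST-ORDER
form is on it: the derivative r_N = ∂_δ(NESS) restricted to observables left of the right bath
solves r(L_T F) = −(γ/2T²)·Cov_Gibbs_N(p_0², F) EXACTLY (Gaussian integration by parts, ∂_(T_L)L =
γ∂²_(p_0): KunduDharNarayan2009, ReyBellet2003 Rem 4.4), and so does half the thermal response ½∂_T
Gibbs_N; their difference r̃_N is, at every N, a tempered HOMOGENEOUS first-order stationary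
functional of the singly-thermostatted half-line with r̃_N(p_0²) = −E_N (Cov_N(H, p_0²) = T²), and
any subsequence with E_N ≥ ε converges on windows to a non-zero radiating functional of the
half-line — so a Liouville theorem for that ONE object gives "no ballistic channel in linear
response" with no nonlinear↔linear interchange (the step that sank the bulk analogue into a
uniform-in-time second-order bound, cf. CurrentTiltQuench.UniformQuadraticResponse).
Imported areas: Liouville/rigidity for stationary Fokker–Planck functionals (the L²-normal core of
the crux is the Eckmann–Pillet–Rey-Bellet controllability induction along the chain,
EckmannPilletReyBellet1999a §3, now in infinite volume and closed by tail triviality of the 1-D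
Gibbs state, GeorgiiGibbsMeasures2011 Ch. 7), the hydrodynamic-projection picture of tempered
first-order invariants (Doyon2022, the isolated-bulk twin), compactness of boundary-driven states
seen FROM the reservoir (EyinkLebowitzSpohn1991; BernardinOlla2011 Thm 3, stochastic), and the
point-thermostat scattering theory of the harmonic chain as the failing corner (KomorowskiEtAl2020,
KomorowskiOlla2020: absorption probability 𝔤(k) < 1 = the radiating functional). No physical analogy
is load-bearing.
What it does that prior routes / negatives do not: the only route whose N-free object is the
thermostatted HALF-LINE (all open routes work in the bulk: Green–Kubo, Drude weight,
macro-ergodicity, kinetic corners); the negatives index has no FouriersLaw entry.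

RANKED CRUXES. #2 FirstOrderRigidity (crux) — FIRST-ORDER LIOUVILLE THEOREM (card K3,
linear-response form). Half-line pinned chain (U = ω₂q²/2 + lam·q⁴/4, V = r²/2 + β·r⁴/4, all
parameters > 0), ONE Langevin bath (T, γ) at site 0, nothing at infinity. A first-order functional
is r : (n : ℕ) → (PhaseSpace n → ℝ) → ℝ (value on a cylinder observable of sites 0..n−1);
hypotheses: linear on temperate (Function.HasTemperateGrowth) observables; consistent (r (n+1) (g ∘
castSucc-window) = r n g); normalised (r n 1 = 0); TEMPERED: for every window length n and weight m
there is C with |r (a+n) (g read on sites a..a+n−1)| ≤ C for all positions a and all temperate g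
with |g z| ≤ (1+‖z‖)^m; STATIONARY to first order: r (n+1) (L_T g) = 0 for every temperate g on n
sites, where L_T g is the tree's window generator (pinnedChain …).generator (n+1) T T (g ∘ castSucc)
(its right-bath term acts on the ignored momentum p_n and vanishes, its Hamiltonian part is the
half-line's). CLAIM: r n g = 0 for all temperate g. Radiating functionals (steady first-order energy
flux to/from infinity with bounded first-order temperatures) are exactly what this forbids; ν − μ_T
for any tempered weak-stationary ν shows it contains the card's nonlinear uniqueness. [difficulty:
XL] (why it might fail: A hidden conserved local charge or any ballistic channel yields a tempered
radiating functional exactly as at lam=β=0 (KomorowskiEtAl2020: absorption prob. 𝔤(k)<1;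
SpohnLebowitz1977); a non-Gibbs tempered stationary ν of the half-line (KAM tori, breathers) gives
ν−μ_T ≠ 0.) [EckmannPilletReyBellet1999a, KomorowskiEtAl2020, KomorowskiOlla2020, SpohnLebowitz1977,
Doyon2022, FritzFunakiLebowitz1994, GeorgiiGibbsMeasures2011, Mazur1969]
#3 LinearResponseTightness (crux) — N- AND POSITION-UNIFORM FIRST-ORDER BOUNDS (the compactness
input; card K1 in linear-response form). Under weak-NESS uniqueness, for pinnedChain (all parameters
> 0), T > 0 and the steady-state family μ: for every window length n and weight m there is C such
that for all N, all positions a with a + n + 2 ≤ N (window left of the right bath) and all temperate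
g with |g z| ≤ (1+‖z‖)^m, every derivative d at δ = 0 of δ ↦ ∫ g(sites a..a+n−1) dμ_(N, T+δ/2,
T−δ/2) satisfies |d| ≤ C. Physically: first-order local temperatures/observables are O(1) uniformly
(a max-principle-type a-priori bound, true even for the ballistic harmonic chain,
RiederLebowitzLieb1967) — it carries no transport content, only compactness. [difficulty: XL] (why
it might fail: No N-uniform bound on ANY NESS response is known (fixed-N class: constants of
CuneoEckmannHairerReyBellet2018/Carmona2007 grow with N); energy localisation near hot spots
(Hairer2009, breathers) could make first-order site energies grow with N.) [HairerMajda2009,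
CuneoEckmannHairerReyBellet2018, Carmona2007, Bernardin2014, Hairer2009, RiederLebowitzLieb1967]
#4 EscapeLawOfNoBallisticChannel (crux) — IMPORT SLOT — "BALLISTIC OR FOURIER" AT THE THERMOSTAT
(witness-first). Under weak-NESS uniqueness, for every T > 0 there is κ_b > 0 such that for the
steady-state family and every sequence e_N of boundary responses (derivative at δ = 0 of δ ↦ ∫ p_0²
dμ_(N+1, T+δ/2, T−δ/2)): e_N → 1/2 ⇒ N·γ·(1/2 − e_N) → κ_b. Logically ≡ EscapeLaw ∨ (ballistic
channel): strictly weaker than escape-deficit's EscapeLaw (stmt-2947 of the retired route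
EscapeDeficit): it is closed a fortiori by EscapeLaw together with that route's ResponseIdentity
(kernel deficit = 1/2 − e_N), by any proof of FouriersLaw(ii) together with FirstOrderResponse +
ResponseIdentity below, or by GreenKubo + ThermodynamicLimit of route FourierGreenKubo. NOT this
route's mechanism; provers of this route should not start here. [difficulty: open-problem] (why it
might fail: It asserts 'not ballistic ⇒ diffusive with a limit': anomalous scaling N·γ·E_N → 0 or ∞
(κ_N ~ N^α, expected only for momentum-conserving chains, LepriLiviPoliti2003 §5) or oscillation of
N·γ·E_N refutes it while NoBallisticChannel holds.) [BonettoLebowitzReyBellet2000,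
KunduDharNarayan2009, LepriLiviPoliti2003, AokiLukkarinenSpohn2006, Dhar2008]
#9 NessUnique (support) — UNIQUENESS OF THE WEAK STEADY STATE at every N, T_L, T_R > 0 (identical
signature to stmt-AtomisticToContinuum-0741 of FourierGreenKubo / CurrentTiltQuench; dedup
intended). With the landed existence theorem pinnedChain_exists_isSteadyState it is clause (i) of
FouriersLawFor and the hypothesis of every fixed-N item below. [difficulty: L]
[CuneoEckmannHairerReyBellet2018, Carmona2007, EthierKurtz1986]
#9 FirstOrderResponse (support) — FIXED-N FIRST-ORDER RESPONSE (de-vacuifier of ranks 3, 4 and of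
NoBallisticChannel). Under uniqueness, for the steady-state family: (a) the weak equation extends to
temperate tests — F and L F integrable and ∫ L F dμ = 0 for every temperate F (all polynomial
moments: e^(ϑH) ∈ L¹ for the CEHR measure, in tree); (b) δ ↦ ∫ g(sites a..a+n−1) dμ_(N, T+δ/2,
T−δ/2) is differentiable at 0 for every temperate cylinder g; (c) in particular δ ↦ ∫ p_0² dμ_(N+1,
T±δ/2) is. Hypoelliptic linear response at fixed N (HairerMajda2009 framework with the CEHR2018
(2.5) Lyapunov–spectral-gap input, as for FiniteResponseOfUnique stmt-0717). [difficulty: L]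
[HairerMajda2009, CuneoEckmannHairerReyBellet2018, ReyBellet2003, Carmona2007]
#9 ResponseIdentity (support) — RESPONSE IDENTITY D_(N+1) = N·γ·(1/2 − e_N) (escape-deficit's (R) in
difference-quotient form, no kernels): under uniqueness, if e is the derivative at 0 of δ ↦ ∫ p_0²
dμ_(N+1, T+δ/2, T−δ/2) then totalCurrent(μ_(N+1, T+δ/2, T−δ/2))/δ → N·γ·(1/2 − e) as δ → 0, δ ≠ 0.
Content: in every steady state with moments all N bond currents have the same mean J̃ = γ(T_L −
⟨p_0²⟩) (∫ L(p_0²/2 + U(q_0)) dμ = 0, ∫ L V(q_1 − q_0) dμ = 0, ∫ L e_x dμ = 0 with cutoffs), and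
⟨p_0²⟩ = T at δ = 0 (the Gibbs state is THE steady state: pinnedChain_isSteadyState_gibbsMeasure +
uniqueness). N+1 = 1: both sides are 0. [difficulty: M] [BonettoLebowitzReyBellet2000,
KunduDharNarayan2009, ReyBellet2003]
#9 NoBallisticChannel (support) — THE RUNG (Z's output, stated alone so that EscapeDeficit /
FeketeResistance / SuperadditiveJunction-type lines can want it): under uniqueness, for every T > 0,
the boundary responses e_N of the steady-state family converge to 1/2 — equivalently E_N → 0, D_N =
o(N), the open chain has NO BALLISTIC CHANNEL in linear response (complete first-order
thermalisation of the thermostatted site). Closed by RigidityGlue from ranks 2–3; false for the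
harmonic chain (E_N → E_∞ > 0, RiederLebowitzLieb1967). [difficulty: XL]
[BonettoLebowitzReyBellet2000, RiederLebowitzLieb1967, BernardinOlla2011, AokiKusnezov2001]
#9 RigidityGlue (support) — THE MECHANISM'S GLUE: NessUnique → FirstOrderResponse →
LinearResponseTightness → FirstOrderRigidity → NoBallisticChannel. Proof plan: if e_N ≤ 1/2 − ε
along a subsequence, set r̃_N := r_N − ½·T⁻²Cov_Gibbs_N(H_N, ·) on observables of sites left of the
right bath; (i) EXACT finite-N homogeneity r̃_N(L_T F) = 0 for left-local temperate F (differentiate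
∫ L_δ F dμ^δ = 0 at δ = 0 using (a)–(b) of FirstOrderResponse and μ^0 = Gibbs_N; differentiate ∫
L_(T',T') F dGibbs_N,T' = 0 in T'; Gaussian IBP ∫∂²_(p_0)F dGibbs = T⁻²Cov(p_0², F); independence of
p_(N−1) kills the right-bath term); (ii) r̃_N(p_0²) = e_N − 1/2; (iii) weighted bounds uniform in N
and position: LinearResponseTightness for r_N, uniform exponential decay of correlations of the
log-concave 1-D finite Gibbs chain for the thermal part (BrascampLieb1976); (iv) diagonal
subsequence on a countable family dense in each weighted class + equicontinuity ⇒ a limit r̃_∞ on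
all temperate cylinder tests, linear, consistent, normalised, tempered, homogeneous (the window
generator maps temperate cylinders to temperate cylinders) with r̃_∞(p_0²) ≤ −ε, contradicting
FirstOrderRigidity. [difficulty: L] [EyinkLebowitzSpohn1991, BernardinOlla2011, BrascampLieb1976,
GeorgiiGibbsMeasures2011, LanfordLebowitzLieb1977]
#9 HarmonicCalibration (support) — ANTI-VACUITY / CALIBRATION: for the HARMONIC half-line
(pinnedChain ω₂ 0 0 γ, ω₂, γ, T > 0) there IS a non-zero functional satisfying every hypothesis of
FirstOrderRigidity — e.g. ν − μ_T for a radiating tempered Gaussian stationary state ν (incoming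
thermal radiation at T' ≠ T, partially absorbed at the thermostat: KomorowskiEtAl2020
reflection/absorption coefficients; SpohnLebowitz1977 / DudnikovaKomechSpohn2003 stationary Gaussian
states). Certifies that the crux is genuinely anharmonic and that its hypotheses do not force r = 0
by themselves; a refutation of THIS item signals a typing slip in rank 2. [difficulty: M]
[KomorowskiEtAl2020, SpohnLebowitz1977, DudnikovaKomechSpohn2003, RiederLebowitzLieb1967,
Nakazawa1970]

TWO-LAYER PLAN. FirstOrderRigidity ⇐ SquareIntegrableRigidity → NoRadiatingFunctional →
FirstOrderRigidity, where SquareIntegrableRigidity: a tempered homogeneous functional that is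
L²-normal w.r.t. the half-line Gibbs state (r = ⟨h, ·⟩, h ∈ L²) vanishes — dissipation ⟨h, L†h⟩ =
−γT‖∂_(p_0)h‖² = 0, then the EckmannPilletReyBellet1999a controllability induction site by site (V″
≥ 1 couples q_k to p_(k+1)) makes h tail-measurable, and the 1-D Gibbs tail is trivial
(provable-grade, L); NoRadiatingFunctional: every tempered homogeneous functional is L²-normal (the
anti-ballistic core, XL). LinearResponseTightness ⇐ (end-window bounds) → (bulk-window bounds, by
reflection symmetry the same) → LinearResponseTightness, or ⇐ a dynamical energy-positivity
statement (card dynamical-energy-positivity-dep) giving a first-order maximum principle. Nothing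
here is filed now.

KILL CRITERIA. ¬FirstOrderRigidity — an explicit non-zero tempered homogeneous first-order
functional of the ANHARMONIC thermostatted half-line (a radiating linear mode, e.g. from a hidden
conserved charge) — closes the route `refuted:FirstOrderRigidity` and is itself a headline (a
deterministic anharmonic chain with a ballistic channel at first order; it would also sink
EscapeDeficit's HalfChainTailLaw and every Green–Kubo line via Mazur). ¬LinearResponseTightness
(first-order local responses growing with N) forces a pivot to the nonlinear form of the card
(fixed-δT rung via NessTightness + NoFlux of the retired route, plus an interchange crux) or
retirement. ¬EscapeLawOfNoBallisticChannel with NoBallisticChannel standing (anomalous or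
oscillating N·γ·E_N) refutes only the import slot and, physically, the conjunct itself.
¬HarmonicCalibration means rank 2 is mis-typed (repair by restate, not a kill). Proved elsewhere:
EscapeDeficit's EscapeLaw or FourierGreenKubo's GreenKubo ∧ ThermodynamicLimit moot rank 4; nothing
moots ranks 2–3 (they are this line's content and are wanted as the anti-ballistic input by the
boundary programme).

NOT DECOMPOSED YET. The split of FirstOrderRigidity into its L²-normal core and the radiating part
(Two-layer plan); the three estimates inside RigidityGlue (uniform Gibbs covariance decay,
temperate-class stability of the window generator, the diagonal/equicontinuity step); the
T-dependence of all constants; the right-end mirror statements (reflection symmetry makes them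
identical); the nonlinear corollaries (uniqueness of tempered weak-stationary states of the
half-line = the card's K3, and the fixed-δT rung BoundaryThermalisation of the retired route) —
deliberately NOT items: they are consequences, not inputs, of rank 2; any identification of κ_b
(left to the routes owning the import slot).

CHEAPEST FALSIFIER. (1) Typing/vacuity: try to prove FirstOrderRigidity WITHOUT using lam, β > 0 —
if the hypotheses force r = 0 for the harmonic chain too, HarmonicCalibration is false and rank 2 is
mis-typed (refuters: construct ν − μ_T for the half-line harmonic chain with one OU bath from the
explicit Gaussian scattering states; KomorowskiEtAl2020 §2 gives the absorption coefficient 𝔤(k) = …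
< 1 to check against). (2) Numerics (kit, not run here — hub is compute-free and this is a one-shot
planner seat): pinnedChain(1,1,1,1), T = 1, symmetric driving δ = ±0.1, N = 8…128: estimate e_N =
(⟨p_0²⟩_(+δ) − ⟨p_0²⟩_(−δ))/(2δ); the line dies if 1/2 − e_N does not decay (ballistic channel) and
the import slot dies if N(1/2 − e_N) drifts to 0 or ∞ (AokiKusnezov2001-type boundary-jump data
already show the jumps shrinking with N). (3) Lookup done: no printed uniqueness/Liouville statement
for the thermostatted anharmonic half-line (searches in § Novelty).

NUMBERS. Harmonic calibration: for lam = β = 0 the per-bond current tends to c_∞·δT > 0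
(RiederLebowitzLieb1967; in tree HarmonicChainBallisticFlux), so E_N → E_∞ = c_∞/γ > 0 and e_N → 1/2
− E_∞ < 1/2; point-thermostat scattering: p_+(k) + p_−(k) + 𝔤(k) = 1 with 𝔤 < 1 (KomorowskiEtAl2020
(1.3)). Expected anharmonic behaviour: kinetic scaling κ(T) ∝ (lam·T)^(−2) at small lam·T for
quartic pinning (AokiLukkarinenSpohn2006 §3; LefevereSchenkel2006), hence E_N ≈ κ(T)/(γN) → 0 at
rate 1/N and e_N → 1/2 from below; all constants T-dependent, none uniform as T → 0.

DEFINITION REQUESTS. None: every statement is typed over existing declarations (PhaseSpace,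
pinnedChain, OscillatorChain.generator/IsSteadyState/totalCurrent, Function.HasTemperateGrowth,
HasDerivAt). A named Literature home for "tempered first-order stationary functional of the
thermostatted half-line" (the five hypotheses of rank 2) would shorten ranks 2 and the calibration
item; not requested now (one-shot seat), suggested to the tenure planner.

Novelty: Searches (2026-08-15): `lit search --hybrid "linear response nonequilibrium stationary state
anharmonic chain heat bath derivative temperature Kubo formula open system"` (12 book hits, all
generic NEMD/linear-response texts: evans2008, livi2017, kamenev2023, zwanzig2001 …); `lit galaxy
search "semi-infinite chain" --star all` (41 rows: harmonic semi-infinite chains in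
surface/Green-function/scattering physics, SSEP-type and quantum-impurity items; no thermostatted
anharmonic uniqueness statement); `lit galaxy search "semi-infinite chain of oscillators coupled to
a heat bath" --star all` (0 rows); `lit search --source arxiv "Komorowski Olla thermostat"` (11
hits: the point-Langevin-thermostat programme arXiv:1806.02089 = KomorowskiEtAl2020,
arXiv:1910.00342 = KomorowskiOlla2020, KomorowskiOlla2021, arXiv:2101.04360, arXiv:1903.02621,
arXiv:2505.06952 — harmonic chains, with or without conservative bulk noise; `lit read
arxiv:1910.00342` pp. 1–3: interface conditions (1.3), p_+ + p_− + 𝔤 = 1); the remote cascade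
(`--source all`) answered rc 75 once and OpenAlex 429 (logged); plus the card's two refuter audits
(crossref ×4, zbMATH, Liggett Ch. VIII grep, `lit read` arXiv:1105.0493 p. 18) and the gen-1 route's
galaxy ×3 (0 rows) and `lit vsearch` (no paper hit).
Nearest prior art found: KomorowskiEtAl2020 / KomorowskiOlla2020 / KomorowskiOlla2021 (infinite
HARMONIC chain with ONE Langevin thermostat: phonons are transmitted/reflected/absorbed, 𝔤(k) < 1 —
the explicit radiating st  [refs: 1806.02089, 1910.00342, 2101.04360, 1903.02621, 2505.06952, 1105.0493, arxiv:1910.00342, KomorowskiEtAl2020, KomorowskiOlla2020, KomorowskiOlla2021, EckmannPilletReyBellet1999a, EyinkLebowitzSpohn1991, BernardinOlla2011, Liggett2005, Fritz1986, FritzFunakiLebowitz1994, KunduDharNarayan2009, ReyBellet2003, Doyon2022]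

Barriers (technique_class: single-thermostat-rigidity, liouville-uniqueness): - technique_class: single-thermostat-rigidity, liouville-uniqueness
- Literature.Barriers.AtomisticToContinuum.HasBoundedResponse: not evaded for the conjunct and not
claimed — the route's own output NoBallisticChannel (D_N = o(N)) is weaker than HasBoundedResponse
(D_N = O(1)), which enters only through the import slot (rank 4); LinearResponseTightness is an
N-uniform first-order bound, but on LOCAL observables (O(1) per site, true for the ballistic
harmonic chain as well), not on the extensive D_N, so it sits beside the barrier's statement, not
inside it; rank 2 is N-free.
- Literature.Barriers.AtomisticToContinuum.MacroErgodicityBarrier: rank 2 is a classification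
statement for (first-order) stationary states of an infinite deterministic system — the same family,
honestly; it is weaker/different in three checkable ways: one boundary bath supplies dissipation and
the reference temperature, the statement is LINEAR around Gibbs with a Hilbert-space core provable
by controllability + tail triviality, and no translation invariance / block estimates / sector
condition are involved (SectorCondition.eq_zero concerns the non-gradient method, unused). The bet
is that the radiating (non-L²) part is provable where macro-ergodicity is not.
- Literature.Barriers.AtomisticToContinuum.HarmonicChainBallisticFlux: consistent and USED — at lam
= β = 0 rank 2 is false (HarmonicCalibration; RiederLebowitzLieb1967 flat profile ⇒ E_∞ > 0;
KomorowskiEtAl2020 𝔤 < 1), so every step that matters use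

History (route lifecycle, newest last):
- 2026-08-22T12:17:03Z · DORMANT — reconciler: no traction for 5.3 d (last activity item-evidence-added at 2026-08-17T04:02:40Z); parked, not closed — `ledger route dormant route-AtomisticToConti (operator:999:912235)

sub-problem: FouriersLaw · status: dormant · opened planner-plancard-AtomisticToContinuum-Fourier-bd64c315-g2-0 2026-08-15T19:02:50Z · rev 1 · ledger route-AtomisticToContinuum-ThermostatLiouville
GENERATED by the gate from the ledger (D-0016/17). Provers cite these decls: `theorem foo : Summit.AtomisticToContinuum.FouriersLaw.Theses.ThermostatLiouville.<Decl> := …` in Summits/AtomisticToContinuum/FouriersLaw/Theorems/<Name>.lean.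
-/

namespace Summit.AtomisticToContinuum.FouriersLaw.Theses.ThermostatLiouville

open scoped BigOperators Topology Manifold Classical MeasureTheory ProbabilityTheory Matrix InnerProductSpace ComplexConjugate ContinuousMap
open Filter Set Function TopologicalSpace MeasureTheory

attribute [summit_statement] _root_.FouriersLaw

/-- item stmt-AtomisticToContinuum-13699 · crux · rank 2 · open · by planner
why it might fail: A hidden conserved local charge or any ballistic channel yields a tempered radiating functional exactly as at lam=β=0 (KomorowskiEtAl2020: absorption prob. 𝔤(k)<1; SpohnLebowitz1977); a non-Gibbs tempered stationary ν of the half-line (KAM tori, breathers) gives ν−μ_T ≠ 0.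
sources: EckmannPilletReyBellet1999a, KomorowskiEtAl2020, KomorowskiOlla2020, SpohnLebowitz1977, Doyon2022, FritzFunakiLebowitz1994
[crux] FIRST-ORDER LIOUVILLE THEOREM (card K3, linear-response form). Half-line pinned chain (U =
ω₂q²/2 + lam·q⁴/4, V = r²/2 + β·r⁴/4, all parameters > 0), ONE Langevin bath (T, γ) at site 0,
nothing at infinity. A first-order functional is r : (n : ℕ) → (PhaseSpace n → ℝ) → ℝ (value on a
cylinder observable of sites 0..n−1); hypotheses: linear on temperate (Function.HasTemperateGrowth)
observables; consistent (r (n+1) (g ∘ castSucc-window) = r n g); normalised (r n 1 = 0); TEMPERED: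
for every window length n and weight m there is C with |r (a+n) (g read on sites a..a+n−1)| ≤ C for
all positions a and all temperate g with |g z| ≤ (1+‖z‖)^m; STATIONARY to first order: r (n+1) (L_T
g) = 0 for every temperate g on n sites, where L_T g is the tree's window generator (pinnedChain
…).generator (n+1) T T (g ∘ castSucc) (its right-bath term acts on the ignored momentum p_n and
vanishes, its Hamiltonian part is the half-line's). CLAIM: r n g = 0 for all temperate g. Radiating
functionals (steady first-order energy flux to/from infinity with bounded first-order temperatures)
are exactly what this forbids; ν − μ_T for any tempered weak-stationary ν shows it contains the
card's nonlinear uniq -/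
@[route_item "route-AtomisticToContinuum-ThermostatLiouville", crux]
def FirstOrderRigidity : Prop :=
  ∀ ω₂ lam β γ : ℝ, 0 < ω₂ → 0 < lam → 0 < β → 0 < γ → ∀ T : ℝ, 0 < T → ∀ r : (n : ℕ) → (Literature.MathematicalPhysics.KineticTheory.HeatConduction.PhaseSpace n → ℝ) → ℝ, (∀ (n : ℕ) (a b : ℝ) (g h : Literature.MathematicalPhysics.KineticTheory.HeatConduction.PhaseSpace n → ℝ), g.HasTemperateGrowth → h.HasTemperateGrowth → r n (fun z => a * g z + b * h z) = a * r n g + b * r n h) → (∀ (n : ℕ) (g : Literature.MathematicalPhysics.KineticTheory.HeatConduction.PhaseSpace n → ℝ), g.HasTemperateGrowth → r (n + 1) (fun y => g (fun i => y.1 (Fin.castSucc i), fun i => y.2 (Fin.castSucc i))) = r n g) → (∀ n : ℕ, r n (fun _ => 1) = 0) → (∀ n m : ℕ, ∃ C : ℝ, ∀ (a : ℕ) (g : Literature.MathematicalPhysics.KineticTheory.HeatConduction.PhaseSpace n → ℝ), g.HasTemperateGrowth → (∀ z, |g z| ≤ (1 + ‖z‖) ^ m) → |r (a + n) (fun y =>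 g (fun i => y.1 (Fin.natAdd a i), fun i => y.2 (Fin.natAdd a i)))| ≤ C) → (∀ (n : ℕ) (g : Literature.MathematicalPhysics.KineticTheory.HeatConduction.PhaseSpace n → ℝ), g.HasTemperateGrowth → r (n + 1) (fun y => (Literature.MathematicalPhysics.KineticTheory.HeatConduction.pinnedChain ω₂ lam β γ).generator (n + 1) T T (fun y' => g (fun i => y'.1 (Fin.castSucc i), fun i => y'.2 (Fin.castSucc i))) y) = 0) → ∀ (n : ℕ) (g : Literature.MathematicalPhysics.KineticTheory.HeatConduction.PhaseSpace n → ℝ), g.HasTemperateGrowth → r n g = 0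

/-- item stmt-AtomisticToContinuum-13700 · crux · rank 3 · open · by planner
why it might fail: No N-uniform bound on ANY NESS response is known (fixed-N class: constants of CuneoEckmannHairerReyBellet2018/Carmona2007 grow with N); energy localisation near hot spots (Hairer2009, breathers) could make first-order site energies grow with N.
sources: HairerMajda2009, CuneoEckmannHairerReyBellet2018, Carmona2007, Bernardin2014, Hairer2009, RiederLebowitzLieb1967
[crux] N- AND POSITION-UNIFORM FIRST-ORDER BOUNDS (the compactness input; card K1 in linear-response
form). Under weak-NESS uniqueness, for pinnedChain (all parameters > 0), T > 0 and the steady-state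
family μ: for every window length n and weight m there is C such that for all N, all positions a
with a + n + 2 ≤ N (window left of the right bath) and all temperate g with |g z| ≤ (1+‖z‖)^m, every
derivative d at δ = 0 of δ ↦ ∫ g(sites a..a+n−1) dμ_(N, T+δ/2, T−δ/2) satisfies |d| ≤ C. Physically:
first-order local temperatures/observables are O(1) uniformly (a max-principle-type a-priori bound,
true even for the ballistic harmonic chain, RiederLebowitzLieb1967) — it carries no transport
content, only compactness. [difficulty: XL] -/
@[route_item "route-AtomisticToContinuum-ThermostatLiouville", crux]
def LinearResponseTightness : Prop :=
  ∀ ω₂ lam β γ : ℝ, 0 < ω₂ → 0 < lam → 0 < β → 0 < γ → (∀ (N : ℕ) (T_L T_R : ℝ), 0 < T_L → 0 < T_R → ∀ μ ν : MeasureTheory.Measure (Literature.MathematicalPhysics.KineticTheory.HeatConduction.PhaseSpace N), (Literature.MathematicalPhysics.KineticTheory.HeatConduction.pinnedChain ω₂ lam β γ).IsSteadyState N T_L T_R μ → (Literature.MathematicalPhysics.KineticTheory.HeatConduction.pinnedChain ω₂ lam β γ).IsSteadyState N T_L T_R ν → μ = ν) → ∀ T : ℝ, 0 < T → ∀ μ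 : (N : ℕ) → ℝ → ℝ → MeasureTheory.Measure (Literature.MathematicalPhysics.KineticTheory.HeatConduction.PhaseSpace N), (∀ (N : ℕ) (T_L T_R : ℝ), 0 < T_L → 0 < T_R → (Literature.MathematicalPhysics.KineticTheory.HeatConduction.pinnedChain ω₂ lam β γ).IsSteadyState N T_L T_R (μ N T_L T_R)) → ∀ n m : ℕ, ∃ C : ℝ, ∀ (N a : ℕ) (h : a + n + 2 ≤ N) (g : Literature.MathematicalPhysics.KineticTheory.HeatConduction.PhaseSpace n → ℝ), g.HasTemperateGrowth → (∀ z, |g z| ≤ (1 + ‖z‖) ^ m) → ∀ d : ℝ, HasDerivAt (fun δ : ℝ => ∫ x, g (fun i => x.1 (Fin.castLE ((Nat.le_add_right (a + n) 2).trans h) (Fin.natAdd a i)), fun i => x.2 (Fin.castLE ((Nat.le_add_right (a + n) 2).trans h) (Fin.natAdd a i))) ∂(μ N (T + δ / 2) (T - δ / 2))) d 0 → |d| ≤ C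

/-- item stmt-AtomisticToContinuum-13701 · crux · rank 4 · open · by planner
why it might fail: It asserts 'not ballistic ⇒ diffusive with a limit': anomalous scaling N·γ·E_N → 0 or ∞ (κ_N ~ N^α, expected only for momentum-conserving chains, LepriLiviPoliti2003 §5) or oscillation of N·γ·E_N refutes it while NoBallisticChannel holds.
sources: BonettoLebowitzReyBellet2000, KunduDharNarayan2009, LepriLiviPoliti2003, AokiLukkarinenSpohn2006, Dhar2008
[crux] IMPORT SLOT — "BALLISTIC OR FOURIER" AT THE THERMOSTAT (witness-first). Under weak-NESS
uniqueness, for every T > 0 there is κ_b > 0 such that for the steady-state family and every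
sequence e_N of boundary responses (derivative at δ = 0 of δ ↦ ∫ p_0² dμ_(N+1, T+δ/2, T−δ/2)): e_N →
1/2 ⇒ N·γ·(1/2 − e_N) → κ_b. Logically ≡ EscapeLaw ∨ (ballistic channel): strictly weaker than
escape-deficit's EscapeLaw (stmt-2947 of the retired route EscapeDeficit): it is closed a fortiori
by EscapeLaw together with that route's ResponseIdentity (kernel deficit = 1/2 − e_N), by any proof
of FouriersLaw(ii) together with FirstOrderResponse + ResponseIdentity below, or by GreenKubo +
ThermodynamicLimit of route FourierGreenKubo. NOT this route's mechanism; provers of this route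
should not start here. [difficulty: open-problem] -/
@[route_item "route-AtomisticToContinuum-ThermostatLiouville", crux]
def EscapeLawOfNoBallisticChannel : Prop :=
  ∀ ω₂ lam β γ : ℝ, 0 < ω₂ → 0 < lam → 0 < β → 0 < γ → (∀ (N : ℕ) (T_L T_R : ℝ), 0 < T_L → 0 < T_R → ∀ μ ν : MeasureTheory.Measure (Literature.MathematicalPhysics.KineticTheory.HeatConduction.PhaseSpace N), (Literature.MathematicalPhysics.KineticTheory.HeatConduction.pinnedChain ω₂ lam β γ).IsSteadyState N T_L T_R μ → (Literature.MathematicalPhysics.KineticTheory.HeatConduction.pinnedChain ω₂ lam β γ).IsSteadyState N T_L T_R ν → μ = ν) → ∀ T : ℝ, 0 < T → ∃ κb : ℝ, 0 < κb ∧ ∀ μ : (N : ℕ) → ℝ → ℝ → MeasureTheory.Measure (Literature.MathematicalPhysics.KineticTheory.HeatConduction.PhaseSpace N), (∀ (N : ℕ) (T_L T_R : ℝ), 0 < T_L → 0 < T_R → (Literature.MathematicalPhysics.KineticTheory.HeatConduction.pinnedChain ω₂ lam β γ).IsSteadyState N T_L T_R (μ N T_L T_R)) → ∀ e : ℕ →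 ℝ, (∀ N : ℕ, HasDerivAt (fun δ : ℝ => ∫ x, (x.2 (0 : Fin (N + 1))) ^ 2 ∂(μ (N + 1) (T + δ / 2) (T - δ / 2))) (e N) 0) → Filter.Tendsto e Filter.atTop (nhds (1 / 2 : ℝ)) → Filter.Tendsto (fun N : ℕ => (N : ℝ) * γ * (1 / 2 - e N)) Filter.atTop (nhds κb)

/-- item stmt-AtomisticToContinuum-0741 · support · rank 9 · closed · proved by Summit.AtomisticToContinuum.FouriersLaw.Theorems.nessUnique_proof (prover) · by planner
sources: CuneoEckmannHairerReyBellet2018, Carmona2007, EthierKurtz1986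
[crux] UNIQUENESS OF THE WEAK STEADY STATE (the half of stmt-0706 not covered by the landed fact
Literature.MathematicalPhysics.KineticTheory.HeatConduction.CuneoEckmannHairerReyBellet2018_pinnedChain,
p3544): for pinnedChain ω₂ lam β γ (all > 0), every N and T_L, T_R > 0, any two measures in the weak
Fokker–Planck class IsSteadyState (probability, ∫ L f dμ = 0 for f ∈ C_c^∞, bond currents
integrable) coincide. Print: uniqueness of the INVARIANT MEASURE of the Langevin semigroup
(CuneoEckmannHairerReyBellet2018 Thm 2.13(1): C1, C2, CA; Carmona2007 Thm 1.1(iii)); the item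
additionally needs 'weak stationary probability solution of L*μ = 0 ⇒ P_t-invariant' for this
hypoelliptic L with cubic drift (Echeverría 1982 well-posed martingale problem on C_c^∞ +
non-explosion via e^{θH}; Bogachev–Krylov–Röckner–Shaposhnikov 2015 Ch. 5 is non-degenerate only) —
the FP-identification lemma is the formal crux. N = 0: PhaseSpace 0 is a point (unique probability
measure); N = 1: both baths on site 0, OU at temperature (T_L+T_R)/2. This is exactly the hypothesis
of FiniteResponse and ThermodynamicLimit and, with the fact, gives clause (i) of FouriersLawFor. -/
@[route_item "route-AtomisticToContinuum-ThermostatLiouville", crux]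
def NessUnique : Prop :=
  ∀ ω₂ lam β γ : ℝ, 0 < ω₂ → 0 < lam → 0 < β → 0 < γ → ∀ (N : ℕ) (T_L T_R : ℝ), 0 < T_L → 0 < T_R → ∀ μ ν : MeasureTheory.Measure (Literature.MathematicalPhysics.KineticTheory.HeatConduction.PhaseSpace N), (Literature.MathematicalPhysics.KineticTheory.HeatConduction.pinnedChain ω₂ lam β γ).IsSteadyState N T_L T_R μ → (Literature.MathematicalPhysics.KineticTheory.HeatConduction.pinnedChain ω₂ lam β γ).IsSteadyState N T_L T_R ν → μ = ν

/-- `NessUnique` holds: proved by `Summit.AtomisticToContinuum.FouriersLaw.Theorems.nessUnique_proof`. -/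
theorem NessUnique_holds : NessUnique := _root_.Summit.AtomisticToContinuum.FouriersLaw.Theorems.nessUnique_proof

/-- item stmt-AtomisticToContinuum-13702 · support · rank 9 · open · by planner
sources: HairerMajda2009, CuneoEckmannHairerReyBellet2018, ReyBellet2003, Carmona2007
[support] FIXED-N FIRST-ORDER RESPONSE (de-vacuifier of ranks 3, 4 and of NoBallisticChannel). Under
uniqueness, for the steady-state family: (a) the weak equation extends to temperate tests — F and L
F integrable and ∫ L F dμ = 0 for every temperate F (all polynomial moments: e^(ϑH) ∈ L¹ for the
CEHR measure, in tree); (b) δ ↦ ∫ g(sites a..a+n−1) dμ_(N, T+δ/2, T−δ/2) is differentiable at 0 for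
every temperate cylinder g; (c) in particular δ ↦ ∫ p_0² dμ_(N+1, T±δ/2) is. Hypoelliptic linear
response at fixed N (HairerMajda2009 framework with the CEHR2018 (2.5) Lyapunov–spectral-gap input,
as for FiniteResponseOfUnique stmt-0717). [difficulty: L] -/
@[route_item "route-AtomisticToContinuum-ThermostatLiouville", crux]
def FirstOrderResponse : Prop :=
  ∀ ω₂ lam β γ : ℝ, 0 < ω₂ → 0 < lam → 0 < β → 0 < γ → (∀ (N : ℕ) (T_L T_R : ℝ), 0 < T_L → 0 < T_R → ∀ μ ν : MeasureTheory.Measure (Literature.MathematicalPhysics.KineticTheory.HeatConduction.PhaseSpace N), (Literature.MathematicalPhysics.KineticTheory.HeatConduction.pinnedChain ω₂ lam β γ).IsSteadyState N T_L T_R μ → (Literature.MathematicalPhysics.KineticTheory.HeatConduction.pinnedChain ω₂ lam β γ).IsSteadyState N T_L T_R ν → μ = ν) → ∀ μ : (N : ℕ) → ℝ → ℝ → MeasureTheory.Measure (Literature.MathematicalPhysics.KineticTheory.HeatConduction.PhaseSpace N), (∀ (N : ℕ) (T_L T_R : ℝ), 0 < T_L → 0 < T_R → (Literature.MathematicalPhysics.KineticTheory.HeatConduction.pinnedChain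 ω₂ lam β γ).IsSteadyState N T_L T_R (μ N T_L T_R)) → (∀ (N : ℕ) (T_L T_R : ℝ), 0 < T_L → 0 < T_R → ∀ F : Literature.MathematicalPhysics.KineticTheory.HeatConduction.PhaseSpace N → ℝ, F.HasTemperateGrowth → MeasureTheory.Integrable F (μ N T_L T_R) ∧ MeasureTheory.Integrable (fun x => (Literature.MathematicalPhysics.KineticTheory.HeatConduction.pinnedChain ω₂ lam β γ).generator N T_L T_R F x) (μ N T_L T_R) ∧ ∫ x, (Literature.MathematicalPhysics.KineticTheory.HeatConduction.pinnedChain ω₂ lam β γ).generator N T_L T_R F x ∂(μ N T_L T_R) = 0) ∧ (∀ T : ℝ, 0 < T → ∀ (N a n : ℕ) (h : a + n ≤ N) (g : Literature.MathematicalPhysics.KineticTheory.HeatConduction.PhaseSpace n → ℝ), g.HasTemperateGrowth → ∃ d : ℝ, HasDerivAt (fun δ : ℝ => ∫ x, g (fun i => x.1 (Fin.castLE h (Fin.natAdd a i)), fun i => x.2 (Fin.castLE h (Fin.natAdd a i))) ∂(μ N (T + δ / 2) (T - δ / 2))) d 0) ∧ (∀ T : ℝ, 0 < T → ∀ N : ℕ,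 ∃ e : ℝ, HasDerivAt (fun δ : ℝ => ∫ x, (x.2 (0 : Fin (N + 1))) ^ 2 ∂(μ (N + 1) (T + δ / 2) (T - δ / 2))) e 0)

/-- item stmt-AtomisticToContinuum-13703 · support · rank 9 · open · by planner
sources: BonettoLebowitzReyBellet2000, KunduDharNarayan2009, ReyBellet2003
[support] RESPONSE IDENTITY D_(N+1) = N·γ·(1/2 − e_N) (escape-deficit's (R) in difference-quotient
form, no kernels): under uniqueness, if e is the derivative at 0 of δ ↦ ∫ p_0² dμ_(N+1, T+δ/2,
T−δ/2) then totalCurrent(μ_(N+1, T+δ/2, T−δ/2))/δ → N·γ·(1/2 − e) as δ → 0, δ ≠ 0. Content: in every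
steady state with moments all N bond currents have the same mean J̃ = γ(T_L − ⟨p_0²⟩) (∫ L(p_0²/2 +
U(q_0)) dμ = 0, ∫ L V(q_1 − q_0) dμ = 0, ∫ L e_x dμ = 0 with cutoffs), and ⟨p_0²⟩ = T at δ = 0 (the
Gibbs state is THE steady state: pinnedChain_isSteadyState_gibbsMeasure + uniqueness). N+1 = 1: both
sides are 0. [difficulty: M] -/
@[route_item "route-AtomisticToContinuum-ThermostatLiouville", crux]
def ResponseIdentity : Prop :=
  ∀ ω₂ lam β γ : ℝ, 0 < ω₂ → 0 < lam → 0 < β → 0 < γ → (∀ (N : ℕ) (T_L T_R : ℝ), 0 < T_L → 0 < T_R → ∀ μ ν : MeasureTheory.Measure (Literature.MathematicalPhysics.KineticTheory.HeatConduction.PhaseSpace N), (Literature.MathematicalPhysics.KineticTheory.HeatConduction.pinnedChain ω₂ lam β γ).IsSteadyState N T_L T_R μ → (Literature.MathematicalPhysics.KineticTheory.HeatConduction.pinnedChain ω₂ lam β γ).IsSteadyState N T_L T_R ν → μ = ν) → ∀ T : ℝ, 0 < T → ∀ μ : (N : ℕ) → ℝ → ℝ → MeasureTheory.Measure (Literature.MathematicalPhysics.KineticTheory.HeatConduction.PhaseSpace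 N), (∀ (N : ℕ) (T_L T_R : ℝ), 0 < T_L → 0 < T_R → (Literature.MathematicalPhysics.KineticTheory.HeatConduction.pinnedChain ω₂ lam β γ).IsSteadyState N T_L T_R (μ N T_L T_R)) → ∀ (N : ℕ) (e : ℝ), HasDerivAt (fun δ : ℝ => ∫ x, (x.2 (0 : Fin (N + 1))) ^ 2 ∂(μ (N + 1) (T + δ / 2) (T - δ / 2))) e 0 → Filter.Tendsto (fun δ : ℝ => (Literature.MathematicalPhysics.KineticTheory.HeatConduction.pinnedChain ω₂ lam β γ).totalCurrent (μ (N + 1) (T + δ / 2) (T - δ / 2)) / δ) (nhdsWithin 0 {(0 : ℝ)}ᶜ) (nhds ((N : ℝ) * γ * (1 / 2 - e)))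

/-- item stmt-AtomisticToContinuum-13704 · support · rank 9 · open · by planner
sources: BonettoLebowitzReyBellet2000, RiederLebowitzLieb1967, BernardinOlla2011, AokiKusnezov2001
[support] THE RUNG (Z's output, stated alone so that EscapeDeficit / FeketeResistance /
SuperadditiveJunction-type lines can want it): under uniqueness, for every T > 0, the boundary
responses e_N of the steady-state family converge to 1/2 — equivalently E_N → 0, D_N = o(N), the
open chain has NO BALLISTIC CHANNEL in linear response (complete first-order thermalisation of the
thermostatted site). Closed by RigidityGlue from ranks 2–3; false for the harmonic chain (E_N → E_∞
> 0, RiederLebowitzLieb1967). [difficulty: XL] -/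
@[route_item "route-AtomisticToContinuum-ThermostatLiouville"]
def NoBallisticChannel : Prop :=
  ∀ ω₂ lam β γ : ℝ, 0 < ω₂ → 0 < lam → 0 < β → 0 < γ → (∀ (N : ℕ) (T_L T_R : ℝ), 0 < T_L → 0 < T_R → ∀ μ ν : MeasureTheory.Measure (Literature.MathematicalPhysics.KineticTheory.HeatConduction.PhaseSpace N), (Literature.MathematicalPhysics.KineticTheory.HeatConduction.pinnedChain ω₂ lam β γ).IsSteadyState N T_L T_R μ → (Literature.MathematicalPhysics.KineticTheory.HeatConduction.pinnedChain ω₂ lam β γ).IsSteadyState N T_L T_R ν → μ = ν) → ∀ T : ℝ, 0 < T → ∀ μ : (N : ℕ) → ℝ → ℝ → MeasureTheory.Measure (Literature.MathematicalPhysics.KineticTheory.HeatConduction.PhaseSpace N), (∀ (N : ℕ) (T_L T_R : ℝ), 0 < T_L → 0 < T_R → (Literature.MathematicalPhysics.KineticTheory.HeatConduction.pinnedChain ω₂ lam β γ).IsSteadyState N T_L T_R (μ N T_L T_R)) → ∀ e : ℕ → ℝ, (∀ N : ℕ, HasDerivAt (fun δ : ℝ => ∫ x, (x.2 (0 : Fin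 (N + 1))) ^ 2 ∂(μ (N + 1) (T + δ / 2) (T - δ / 2))) (e N) 0) → Filter.Tendsto e Filter.atTop (nhds (1 / 2 : ℝ))

/-- item stmt-AtomisticToContinuum-13705 · support · rank 9 · open · by planner
sources: EyinkLebowitzSpohn1991, BernardinOlla2011, BrascampLieb1976, GeorgiiGibbsMeasures2011, LanfordLebowitzLieb1977
[support] THE MECHANISM'S GLUE: NessUnique → FirstOrderResponse → LinearResponseTightness →
FirstOrderRigidity → NoBallisticChannel. Proof plan: if e_N ≤ 1/2 − ε along a subsequence, set r̃_N
:= r_N − ½·T⁻²Cov_Gibbs_N(H_N, ·) on observables of sites left of the right bath; (i) EXACT finite-N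
homogeneity r̃_N(L_T F) = 0 for left-local temperate F (differentiate ∫ L_δ F dμ^δ = 0 at δ = 0
using (a)–(b) of FirstOrderResponse and μ^0 = Gibbs_N; differentiate ∫ L_(T',T') F dGibbs_N,T' = 0
in T'; Gaussian IBP ∫∂²_(p_0)F dGibbs = T⁻²Cov(p_0², F); independence of p_(N−1) kills the
right-bath term); (ii) r̃_N(p_0²) = e_N − 1/2; (iii) weighted bounds uniform in N and position:
LinearResponseTightness for r_N, uniform exponential decay of correlations of the log-concave 1-D
finite Gibbs chain for the thermal part (BrascampLieb1976); (iv) diagonal subsequence on a countable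
family dense in each weighted class + equicontinuity ⇒ a limit r̃_∞ on all temperate cylinder tests,
linear, consistent, normalised, tempered, homogeneous (the window generator maps temperate cylinders
to temperate cylinders) with r̃_∞(p_0²) ≤ −ε, contradicting FirstOrderRigidity. [difficulty: L] -/
@[route_item "route-AtomisticToContinuum-ThermostatLiouville", crux]
def RigidityGlue : Prop :=
  NessUnique → FirstOrderResponse → LinearResponseTightness → FirstOrderRigidity → NoBallisticChannel

/-- item stmt-AtomisticToContinuum-13706 · support · rank 9 · open · by planner
sources: KomorowskiEtAl2020, SpohnLebowitz1977, DudnikovaKomechSpohn2003, RiederLebowitzLieb1967, Nakazawa1970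
[support] ANTI-VACUITY / CALIBRATION: for the HARMONIC half-line (pinnedChain ω₂ 0 0 γ, ω₂, γ, T >
0) there IS a non-zero functional satisfying every hypothesis of FirstOrderRigidity — e.g. ν − μ_T
for a radiating tempered Gaussian stationary state ν (incoming thermal radiation at T' ≠ T,
partially absorbed at the thermostat: KomorowskiEtAl2020 reflection/absorption coefficients;
SpohnLebowitz1977 / DudnikovaKomechSpohn2003 stationary Gaussian states). Certifies that the crux is
genuinely anharmonic and that its hypotheses do not force r = 0 by themselves; a refutation of THIS
item signals a typing slip in rank 2. [difficulty: M] -/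
@[route_item "route-AtomisticToContinuum-ThermostatLiouville"]
def HarmonicCalibration : Prop :=
  ∀ ω₂ γ T : ℝ, 0 < ω₂ → 0 < γ → 0 < T → ∃ r : (n : ℕ) → (Literature.MathematicalPhysics.KineticTheory.HeatConduction.PhaseSpace n → ℝ) → ℝ, (∀ (n : ℕ) (a b : ℝ) (g h : Literature.MathematicalPhysics.KineticTheory.HeatConduction.PhaseSpace n → ℝ), g.HasTemperateGrowth → h.HasTemperateGrowth → r n (fun z => a * g z + b * h z) = a * r n g + b * r n h) ∧ (∀ (n : ℕ) (g : Literature.MathematicalPhysics.KineticTheory.HeatConduction.PhaseSpace n → ℝ), g.HasTemperateGrowth → r (n + 1) (fun y => g (fun i => y.1 (Fin.castSucc i), fun i => y.2 (Fin.castSucc i))) = r n g) ∧ (∀ n : ℕ, r n (fun _ => 1) = 0) ∧ (∀ n m : ℕ, ∃ C : ℝ, ∀ (a : ℕ) (g : Literature.MathematicalPhysics.KineticTheory.HeatConduction.PhaseSpace n → ℝ), g.HasTemperateGrowth → (∀ z, |g z| ≤ (1 + ‖z‖) ^ m) → |r (a + n) (fun y => g (fun i => y.1 (Fin.natAdd a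 i), fun i => y.2 (Fin.natAdd a i)))| ≤ C) ∧ (∀ (n : ℕ) (g : Literature.MathematicalPhysics.KineticTheory.HeatConduction.PhaseSpace n → ℝ), g.HasTemperateGrowth → r (n + 1) (fun y => (Literature.MathematicalPhysics.KineticTheory.HeatConduction.pinnedChain ω₂ 0 0 γ).generator (n + 1) T T (fun y' => g (fun i => y'.1 (Fin.castSucc i), fun i => y'.2 (Fin.castSucc i))) y) = 0) ∧ ∃ (n : ℕ) (g : Literature.MathematicalPhysics.KineticTheory.HeatConduction.PhaseSpace n → ℝ), g.HasTemperateGrowth ∧ r n g ≠ 0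

/-- item stmt-AtomisticToContinuum-13707 · assembly · rank 1 · open · by planner
sources: BonettoLebowitzReyBellet2000, KunduDharNarayan2009
[assembly] FirstOrderRigidity → LinearResponseTightness → EscapeLawOfNoBallisticChannel → NessUnique
→ FirstOrderResponse → ResponseIdentity → RigidityGlue → FouriersLaw (the type of `closes`, curried;
witnessed by `closes` in the planner's Sketch.lean, rc 0). -/
@[route_item "route-AtomisticToContinuum-ThermostatLiouville"]
def Assembly : Prop :=
  FirstOrderRigidity → LinearResponseTightness → EscapeLawOfNoBallisticChannel → NessUnique → FirstOrderResponse → ResponseIdentity → RigidityGlue → _root_.FouriersLaw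

/-! D-0027 §2.1 — DECIDING THEOREM (planner-authored via `route open/edit --closes-file`; by planner-plancard-AtomisticToContinuum-Fourier-bd64c315-g2-0 2026-08-15T19:02:50Z):
its hypotheses are this route's items and its conclusion the sub-problem Statement (glue_lint), and it elaborates with this file. -/

@[closes "route-AtomisticToContinuum-ThermostatLiouville"] theorem closes (hR : FirstOrderRigidity) (hT : LinearResponseTightness) (hE : EscapeLawOfNoBallisticChannel)
    (hNU : NessUnique) (hFR : FirstOrderResponse) (hRI : ResponseIdentity) (hG : RigidityGlue) :
    _root_.FouriersLaw := by
  have hNB : NoBallisticChannel := hG hNU hFR hT hR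
  intro ω₂ lam β γ hω hl hβ hγ
  have huniq := hNU ω₂ lam β γ hω hl hβ hγ
  refine ⟨?_, ?_⟩
  · intro N T_L T_R hL hR
    obtain ⟨μ, hμ⟩ :=
      Literature.MathematicalPhysics.KineticTheory.HeatConduction.pinnedChain_exists_isSteadyState hω hl hβ hγ N hL hR
    exact ⟨μ, hμ, fun ν hν => huniq N T_L T_R hL hR ν μ hν hμ⟩
  · have hEs := hE ω₂ lam β γ hω hl hβ hγ huniq
    classical
    refine ⟨fun T => if hT : 0 < T then Classical.choose (hEs T hT) else 1, ?_, ?_⟩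
    · intro T hT
      simp only [dif_pos hT]
      exact (Classical.choose_spec (hEs T hT)).1
    · intro μ hμ T hT
      obtain ⟨-, -, hP⟩ := hFR ω₂ lam β γ hω hl hβ hγ huniq μ hμ
      choose e he using hP T hT
      have hlim : Filter.Tendsto e Filter.atTop (nhds (1 / 2 : ℝ)) :=
        hNB ω₂ lam β γ hω hl hβ hγ huniq T hT μ hμ e he
      have hκ := (Classical.choose_spec (hEs T hT)).2 μ hμ e he hlim
      refine ⟨fun N => match N with
        | 0 => 0
        | M + 1 => (M : ℝ) * γ * (1 / 2 - e M), ?_, ?_⟩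
      · intro N
        cases N with
        | zero =>
          have h0 : (fun δ : ℝ =>
              (Literature.MathematicalPhysics.KineticTheory.HeatConduction.pinnedChain ω₂ lam β γ).totalCurrent
                (μ 0 (T + δ / 2) (T - δ / 2)) / δ) = fun _ => (0 : ℝ) := by
            funext δ
            simp
          rw [h0]
          exact tendsto_const_nhds
        | succ M =>
          exact hRI ω₂ lam β γ hω hl hβ hγ huniq T hT μ hμ M (e M) (he M)
      · simp only [dif_pos hT]
        rw [← Filter.tendsto_add_atTop_iff_nat 1]
        exact hκ

end Summit.AtomisticToContinuum.FouriersLaw.Theses.ThermostatLiouville
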